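import Summits.ValiantsHypothesis.ValiantsHypothesis.Theorems.LacunarySymmetroidMatrixDescartesCensusChamberLtri

/-!
# `MatrixDescartes` census — the Λ-RULE: a third sign-level obstruction for symmetric `2 × 2` pencils (two definite
letters, four others), as one kernel lemma with a polynomial proof

HONEST FRAMING.  Object-search cell `pub-symmetroid`, door-A target `DoorA26 := PosRootLawAt 2 6 19`
(stmt-ValiantsHypothesis-19979; OPEN, typed, never asserted), crux `Theses.LacunarySymmetroid.MatrixDescartes`
(stmt-ValiantsHypothesis-18050).  After parity (C22) and theory-2's L-pair/L-tri (N31, kernel: `…CensusChamberLtri.lean`)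
the sign-level atlas of the 5 216 `V = 20` cells of `(2,6)` (theory g6 CHAMBERS-2-6.md §6) left 28 cells «open»: neither
rule-dead nor realised by a Lorentz–Gram witness.  Re-examination (this seat, tools in HOME/val-sym-door-p2/g2/): 8 of
them are realisable (exact witnesses; mirrors of realised cells), and 18 = 9 mirror pairs (two definite letters each)
are killed by ONE new rule, typed here:

* `lambda_rule_false` — **Λ-RULE** (flip-invariant form): two definite letters `P, U` and letters `A B C D` cannot show
  the triangle parities `(P,U,A), (P,U,B), (P,A,C), (P,B,C), (P,C,D)` odd and `(P,U,C), (P,A,B), (P,A,D), (P,B,D)` even.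
  Chart picture (project from `P`; `U ↦ u` inside the unit disc, the others to points `a b c d`, `β(X,Y) < 0 ↔ x·y > 1`):
  `u·a, u·b > 1`, `a·b < 1`, `c·a, c·b > 1 > c·u` force `c` into the open triangle `0ab` (`lambda_side_pos`: `c` and `a`
  on the same side of the line `0b`, by an elementary chain using `|u| < 1`; `cramer_polar_identity`: `C = νP + λA + μB`
  with `λ, μ > 0`, and `ν > 0` by pairing with `U`), whence `d·c < 1` for every `d` with `d·a, d·b < 1` — against
  `β(C,D) < 0`.  Everything is a polynomial identity (`ring`) plus linear arithmetic over opaque reals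
  (`sameSide_of_chart_signs`), the Lagrange identity `Census.polar_lagrange_identity` and reverse Cauchy–Schwarz
  `Census.four_det_mul_det_le_polarDet_sq`;
* the chamber-uniform schema and the 18 instances are in `…CensusChamberLambdaCell.lean` / `…CensusChamberLambdaA.lean`.

Consistency check (outside the kernel): the rule fires on 452 of the 5 216 cells and on NONE of the 2 810 cells with an
exact Lorentz–Gram witness.  SIGN layer only; nothing on magnitude-level cells, on `DoorA26` as a whole (OPEN), the crux,
or `VP ≠ VNP`.

[folklore] Elementary algebra of `2 × 2` symmetric matrices (`Sym₂(ℝ) ≅ ℝ^{1,2}`); the rule and its certificate are this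
seat's, no citation exists.
-/

-- `Summit.ValiantsHypothesis.ValiantsHypothesis.…` repeats a component by the D-0017 layout
-- (single-conjunct summit), which the `dupNamespace` linter flags; the name is mandated.
set_option linter.dupNamespace false

namespace Summit.ValiantsHypothesis.ValiantsHypothesis.Theorems.LacunarySymmetroidMatrixDescartes.Census

open Polynomial Finset
open scoped BigOperators Polynomial Matrix

/-- **Cramer's rule paired with the polarised determinant.**  For entry vectors `P A B C X` of real `2 × 2`
symmetric letters (`β(S,T) = S₀₀T₁₁ + S₁₁T₀₀ − 2S₀₁T₀₁`):
`det[P;A;B]·β(C,X) = det[C;A;B]·β(P,X) + det[P;C;B]·β(A,X) + det[P;A;C]·β(B,X)` — the expansion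
`det[P;A;B]·C = det[C;A;B]·P + det[P;C;B]·A + det[P;A;C]·B` of four vectors of `ℝ³`, paired with `X`. [folklore] -/
theorem cramer_polar_identity (p₀ p₁ p₂ a₀ a₁ a₂ b₀ b₁ b₂ c₀ c₁ c₂ x₀ x₁ x₂ : ℝ) :
    (p₀ * (a₁ * b₂ - a₂ * b₁) - p₁ * (a₀ * b₂ - a₂ * b₀) + p₂ * (a₀ * b₁ - a₁ * b₀))
        * (c₀ * x₂ + c₂ * x₀ - 2 * (c₁ * x₁))
      = (c₀ * (a₁ * b₂ - a₂ * b₁) - c₁ * (a₀ * b₂ - a₂ * b₀) + c₂ * (a₀ * b₁ - a₁ * b₀))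
          * (p₀ * x₂ + p₂ * x₀ - 2 * (p₁ * x₁))
        + (p₀ * (c₁ * b₂ - c₂ * b₁) - p₁ * (c₀ * b₂ - c₂ * b₀) + p₂ * (c₀ * b₁ - c₁ * b₀))
          * (a₀ * x₂ + a₂ * x₀ - 2 * (a₁ * x₁))
        + (p₀ * (a₁ * c₂ - a₂ * c₁) - p₁ * (a₀ * c₂ - a₂ * c₀) + p₂ * (a₀ * c₁ - a₁ * c₀))
          * (b₀ * x₂ + b₂ * x₀ - 2 * (b₁ * x₁)) := by
  ring

/-- Arithmetic core of the Λ-rule («same side of the plane through `P` and `B`»).  Opaque reals: `e_XY` are the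
normalised projected pairings `E(X,Y)/(β(P,X)β(P,Y))` (so `e < 1 ↔ β > 0`), `n_X ∝ det[P;B;X]`, `N = e_BB`, and the four
hypotheses `p··` are instances of the Lagrange identity `Census.polar_lagrange_identity` with `Q = B`.  From
`u·a, u·b, c·a, c·b > 1 > u·c, a·b, |u|²` (chart language) it follows that `a` and `c` lie on the same side of the line
through the origin and `b`: `n_A n_C > 0`. [folklore] -/
theorem sameSide_of_chart_signs {N eAC eAB eBC eUA eUB eUC eUU nA nC nU κ : ℝ} (hκ : 0 < κ)
    (hUA : 1 < eUA) (hUB : 1 < eUB) (hUC : eUC < 1) (hAB : eAB < 1) (hAC : 1 < eAC) (hBC : 1 < eBC)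
    (hUU : eUU < 1) (hUU0 : 0 ≤ eUU)
    (pAC : N * eAC - eAB * eBC = κ * (nA * nC)) (pUU : N * eUU - eUB ^ 2 = κ * nU ^ 2)
    (pUA : N * eUA - eUB * eAB = κ * (nU * nA)) (pUC : N * eUC - eUB * eBC = κ * (nU * nC)) :
    0 < nA * nC := by
  by_contra hcon
  have h : nA * nC ≤ 0 := not_lt.mp hcon
  -- N > 0
  have hN : 0 < N := by
    by_contra hN'
    have hN : N ≤ 0 := not_lt.mp hN'
    have h1 : N * eUU ≤ 0 := mul_nonpos_of_nonpos_of_nonneg hN hUU0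
    nlinarith [sq_nonneg nU, mul_nonneg hκ.le (sq_nonneg nU)]
  -- κ nA nC ≤ 0, hence e_AB e_BC ≥ N e_AC > N
  have h2 : N < eAB * eBC := by
    have : κ * (nA * nC) ≤ 0 := mul_nonpos_of_nonneg_of_nonpos hκ.le h
    nlinarith [mul_lt_mul_of_pos_left hAC hN]
  have hBC0 : 0 < eBC := by linarith
  have hAB0 : 0 < eAB := by
    by_contra h0'
    have h0 : eAB ≤ 0 := not_lt.mp h0'
    nlinarith [mul_nonpos_of_nonpos_of_nonneg h0 hBC0.le]
  -- κ nU nC < 0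
  have h3 : κ * (nU * nC) < 0 := by
    have : eBC * 1 < eUB * eBC := by nlinarith
    have : eAB * eBC < 1 * eBC := by nlinarith
    nlinarith [mul_lt_mul_of_pos_left hUC hN]
  have h3' : nU * nC < 0 := by
    by_contra h0'
    have h0 : 0 ≤ nU * nC := not_lt.mp h0'
    nlinarith [mul_nonneg hκ.le h0]
  -- comparison: -κ nU nC > e_UB e_BC - N > e_AB e_BC - N > -κ nA nC
  have h4 : nC * (nU - nA) < 0 := by
    have hX : eUB * eBC - N < -(κ * (nU * nC)) := by nlinarith [mul_lt_mul_of_pos_left hUC hN]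
    have hY : -(κ * (nA * nC)) < eAB * eBC - N := by nlinarith [mul_lt_mul_of_pos_left hAC hN]
    have hXY : eAB * eBC - N < eUB * eBC - N := by nlinarith
    have : κ * (nC * (nU - nA)) < 0 := by nlinarith
    by_contra h0'
    have h0 : 0 ≤ nC * (nU - nA) := not_lt.mp h0'
    nlinarith [mul_nonneg hκ.le h0]
  have h5 : 0 < nU * (nU - nA) := by
    have hm := mul_pos_of_neg_of_neg h4 h3'
    have e : nC * (nU - nA) * (nU * nC) = nC ^ 2 * (nU * (nU - nA)) := by ring
    rw [e] at hm
    rcases lt_or_ge 0 (nU * (nU - nA)) with hp | hp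
    · exact hp
    · exact absurd hm (not_lt.mpr (mul_nonpos_of_nonneg_of_nonpos (sq_nonneg nC) hp))
  -- N e_UU = e_UB² + κ nU² > e_UB e_AB + κ nU nA = N e_UA
  have h6 : N * eUA < N * eUU := by
    have hsq : eUB * eAB < eUB ^ 2 := by nlinarith
    have hn : κ * (nU * nA) < κ * nU ^ 2 := by
      have : nU * nA < nU ^ 2 := by nlinarith
      exact mul_lt_mul_of_pos_left this hκ
    nlinarith
  have h7 : eUA < eUU := lt_of_mul_lt_mul_left h6 hN.le
  linarith

/-- Division bookkeeping: the Lagrange identity normalised by positive time components. [folklore] -/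
theorem parseval_normalised {tB tX tY π EBB EXY EXB EYB DX DY : ℝ} (htB : tB ≠ 0) (htX : tX ≠ 0) (htY : tY ≠ 0)
    (h : EBB * EXY - EXB * EYB = 2 * π * DX * DY) :
    EBB / tB ^ 2 * (EXY / (tX * tY)) - EXB / (tB * tX) * (EYB / (tB * tY))
      = 2 * π / tB ^ 2 * (DX / tX * (DY / tY)) := by
  field_simp
  linear_combination h

/-- **Λ-rule, side lemma.**  `P` timelike base (`det P > 0`), `U` timelike in the same nappe (`det U > 0`, `β(P,U) > 0`),
letters `A B C` on the positive side of `P` (`β(P,·) > 0`) with `β(U,A), β(U,B) < 0 < β(U,C)`, `β(A,B) > 0`,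
`β(A,C), β(B,C) < 0`.  Then `A` and `C` lie on the same side of the plane through `P` and `B`:
`det[P;B;A] · det[P;B;C] > 0`. [folklore] -/
theorem lambda_side_pos (p₀ p₁ p₂ u₀ u₁ u₂ a₀ a₁ a₂ b₀ b₁ b₂ c₀ c₁ c₂ : ℝ)
    (hP : 0 < p₀ * p₂ - p₁ ^ 2) (hU : 0 < u₀ * u₂ - u₁ ^ 2) (htU : 0 < p₀ * u₂ + p₂ * u₀ - 2 * (p₁ * u₁))
    (htA : 0 < p₀ * a₂ + p₂ * a₀ - 2 * (p₁ * a₁)) (htB : 0 < p₀ * b₂ + p₂ * b₀ - 2 * (p₁ * b₁))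
    (htC : 0 < p₀ * c₂ + p₂ * c₀ - 2 * (p₁ * c₁))
    (hUA : u₀ * a₂ + u₂ * a₀ - 2 * (u₁ * a₁) < 0) (hUB : u₀ * b₂ + u₂ * b₀ - 2 * (u₁ * b₁) < 0)
    (hUC : 0 < u₀ * c₂ + u₂ * c₀ - 2 * (u₁ * c₁)) (hAB : 0 < a₀ * b₂ + a₂ * b₀ - 2 * (a₁ * b₁))
    (hAC : a₀ * c₂ + a₂ * c₀ - 2 * (a₁ * c₁) < 0) (hBC : b₀ * c₂ + b₂ * c₀ - 2 * (b₁ * c₁) < 0) :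
    0 < (p₀ * (b₁ * a₂ - b₂ * a₁) - p₁ * (b₀ * a₂ - b₂ * a₀) + p₂ * (b₀ * a₁ - b₁ * a₀))
      * (p₀ * (b₁ * c₂ - b₂ * c₁) - p₁ * (b₀ * c₂ - b₂ * c₀) + p₂ * (b₀ * c₁ - b₁ * c₀)) := by
  -- abbreviations
  set π := p₀ * p₂ + p₂ * p₀ - 2 * (p₁ * p₁) with hπ
  set tU := p₀ * u₂ + p₂ * u₀ - 2 * (p₁ * u₁) with htU_def
  set tA := p₀ * a₂ + p₂ * a₀ - 2 * (p₁ * a₁) with htA_def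
  set tB := p₀ * b₂ + p₂ * b₀ - 2 * (p₁ * b₁) with htB_def
  set tC := p₀ * c₂ + p₂ * c₀ - 2 * (p₁ * c₁) with htC_def
  set βUA := u₀ * a₂ + u₂ * a₀ - 2 * (u₁ * a₁)
  set βUB := u₀ * b₂ + u₂ * b₀ - 2 * (u₁ * b₁)
  set βUC := u₀ * c₂ + u₂ * c₀ - 2 * (u₁ * c₁)
  set βAB := a₀ * b₂ + a₂ * b₀ - 2 * (a₁ * b₁)
  set βAC := a₀ * c₂ + a₂ * c₀ - 2 * (a₁ * c₁)
  set βBC := b₀ * c₂ + b₂ * c₀ - 2 * (b₁ * c₁)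
  set βUU := u₀ * u₂ + u₂ * u₀ - 2 * (u₁ * u₁) with hβUU
  set βBB := b₀ * b₂ + b₂ * b₀ - 2 * (b₁ * b₁) with hβBB
  set DA := p₀ * (b₁ * a₂ - b₂ * a₁) - p₁ * (b₀ * a₂ - b₂ * a₀) + p₂ * (b₀ * a₁ - b₁ * a₀) with hDA
  set DC := p₀ * (b₁ * c₂ - b₂ * c₁) - p₁ * (b₀ * c₂ - b₂ * c₀) + p₂ * (b₀ * c₁ - b₁ * c₀) with hDC
  set DU := p₀ * (b₁ * u₂ - b₂ * u₁) - p₁ * (b₀ * u₂ - b₂ * u₀) + p₂ * (b₀ * u₁ - b₁ * u₀) with hDU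
  have hπ0 : 0 < π := by
    have e : π = 2 * (p₀ * p₂ - p₁ ^ 2) := by rw [hπ]; ring
    rw [e]; positivity
  -- the four Lagrange identities with Q = B (E(X,Y) = tX tY - π βXY)
  have LAC : (tB * tB - π * βBB) * (tA * tC - π * βAC) - (tB * tA - π * (b₀ * a₂ + b₂ * a₀ - 2 * (b₁ * a₁)))
      * (tB * tC - π * βBC) = 2 * π * DA * DC :=
    polar_lagrange_identity p₀ p₁ p₂ b₀ b₁ b₂ a₀ a₁ a₂ c₀ c₁ c₂
  have LUU : (tB * tB - π * βBB) * (tU * tU - π * βUU) - (tB * tU - π * (b₀ * u₂ + b₂ * u₀ - 2 * (b₁ * u₁)))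
      * (tB * tU - π * (b₀ * u₂ + b₂ * u₀ - 2 * (b₁ * u₁))) = 2 * π * DU * DU :=
    polar_lagrange_identity p₀ p₁ p₂ b₀ b₁ b₂ u₀ u₁ u₂ u₀ u₁ u₂
  have LUA : (tB * tB - π * βBB) * (tU * tA - π * βUA) - (tB * tU - π * (b₀ * u₂ + b₂ * u₀ - 2 * (b₁ * u₁)))
      * (tB * tA - π * (b₀ * a₂ + b₂ * a₀ - 2 * (b₁ * a₁))) = 2 * π * DU * DA :=
    polar_lagrange_identity p₀ p₁ p₂ b₀ b₁ b₂ u₀ u₁ u₂ a₀ a₁ a₂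
  have LUC : (tB * tB - π * βBB) * (tU * tC - π * βUC) - (tB * tU - π * (b₀ * u₂ + b₂ * u₀ - 2 * (b₁ * u₁)))
      * (tB * tC - π * βBC) = 2 * π * DU * DC :=
    polar_lagrange_identity p₀ p₁ p₂ b₀ b₁ b₂ u₀ u₁ u₂ c₀ c₁ c₂
  -- symmetric pairings
  have sBA : b₀ * a₂ + b₂ * a₀ - 2 * (b₁ * a₁) = βAB := by ring
  have sBU : b₀ * u₂ + b₂ * u₀ - 2 * (b₁ * u₁) = βUB := by ring
  rw [sBA] at LAC LUA
  rw [sBU] at LUU LUA LUC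
  -- Aczel: E(U,U) ≥ 0, and E(U,U) < tU²
  have hAcz := four_det_mul_det_le_polarDet_sq p₀ p₁ p₂ u₀ u₁ u₂ hP
  have hπβ : π * βUU = 4 * (p₀ * p₂ - p₁ ^ 2) * (u₀ * u₂ - u₁ ^ 2) := by rw [hπ, hβUU]; ring
  have hEUU0 : 0 ≤ tU * tU - π * βUU := by
    have e : tU * tU = (p₀ * u₂ + p₂ * u₀ - 2 * (p₁ * u₁)) ^ 2 := by rw [htU_def]; ring
    rw [hπβ, e]; linarith [hAcz]
  have hEUU : tU * tU - π * βUU < tU * tU := by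
    have : 0 < π * βUU := by rw [hπβ]; positivity
    linarith
  -- normalised quantities
  have htU0 : tU ≠ 0 := htU.ne'
  have htA0 : tA ≠ 0 := htA.ne'
  have htB0 : tB ≠ 0 := htB.ne'
  have htC0 : tC ≠ 0 := htC.ne'
  -- sign facts, linear after isolating the product π·β
  have xUA : tU * tA < tU * tA - π * βUA := by
    have := mul_pos hπ0 (neg_pos.mpr hUA); rw [mul_neg] at this; linarith
  have xUB : tB * tU < tB * tU - π * βUB := by
    have := mul_pos hπ0 (neg_pos.mpr hUB); rw [mul_neg] at this; linarith
  have xUC : tU * tC - π * βUC < tU * tC := by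
    have := mul_pos hπ0 hUC; linarith
  have xAB : tB * tA - π * βAB < tB * tA := by
    have := mul_pos hπ0 hAB; linarith
  have xAC : tA * tC < tA * tC - π * βAC := by
    have := mul_pos hπ0 (neg_pos.mpr hAC); rw [mul_neg] at this; linarith
  have xBC : tB * tC < tB * tC - π * βBC := by
    have := mul_pos hπ0 (neg_pos.mpr hBC); rw [mul_neg] at this; linarith
  have pUA : 0 < tU * tA := mul_pos htU htA
  have pBU : 0 < tB * tU := mul_pos htB htU
  have pUC : 0 < tU * tC := mul_pos htU htC
  have pBA : 0 < tB * tA := mul_pos htB htA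
  have pAC : 0 < tA * tC := mul_pos htA htC
  have pBC : 0 < tB * tC := mul_pos htB htC
  have pUU : 0 < tU * tU := mul_pos htU htU
  have pB2 : 0 < tB ^ 2 := by positivity
  have nAC := parseval_normalised (EXB := tB * tA - π * βAB) (EYB := tB * tC - π * βBC) htB0 htA0 htC0 LAC
  have nUU := parseval_normalised (EXB := tB * tU - π * βUB) (EYB := tB * tU - π * βUB) htB0 htU0 htU0 LUU
  have nUA := parseval_normalised (EXB := tB * tU - π * βUB) (EYB := tB * tA - π * βAB) htB0 htU0 htA0 LUA
  have nUC := parseval_normalised (EXB := tB * tU - π * βUB) (EYB := tB * tC - π * βBC) htB0 htU0 htC0 LUC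
  have key := sameSide_of_chart_signs (N := (tB * tB - π * βBB) / tB ^ 2)
    (eAC := (tA * tC - π * βAC) / (tA * tC)) (eAB := (tB * tA - π * βAB) / (tB * tA))
    (eBC := (tB * tC - π * βBC) / (tB * tC)) (eUA := (tU * tA - π * βUA) / (tU * tA))
    (eUB := (tB * tU - π * βUB) / (tB * tU)) (eUC := (tU * tC - π * βUC) / (tU * tC))
    (eUU := (tU * tU - π * βUU) / (tU * tU)) (nA := DA / tA) (nC := DC / tC) (nU := DU / tU)
    (κ := 2 * π / tB ^ 2) (div_pos (by linarith) pB2)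
    ((one_lt_div pUA).mpr xUA) ((one_lt_div pBU).mpr xUB) ((div_lt_one pUC).mpr xUC) ((div_lt_one pBA).mpr xAB)
    ((one_lt_div pAC).mpr xAC) ((one_lt_div pBC).mpr xBC) ((div_lt_one pUU).mpr hEUU) (div_nonneg hEUU0 pUU.le)
    (by rw [← nAC]) (by rw [sq ((tB * tU - π * βUB) / (tB * tU)), sq (DU / tU), ← nUU]) (by rw [← nUA])
    (by rw [← nUC])
  -- key : 0 < DA / tA * (DC / tC)
  have : 0 < DA * DC / (tA * tC) := by rw [div_mul_div_comm] at key; exact key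
  exact (div_pos_iff_of_pos_right (by positivity)).mp this

/-- **Λ-RULE, normalised form.**  `P, U` timelike in the same nappe (`det P, det U > 0`, `β(P,U) > 0`), letters
`A B C D` on the positive side of `P`, with `β(U,A), β(U,B) < 0 < β(U,C)`, `β(A,B) > 0`, `β(A,C), β(B,C) < 0`,
`β(A,D), β(B,D) > 0 > β(C,D)` — impossible.  Proof: by `lambda_side_pos` (twice) and Cramer
(`cramer_polar_identity`) `C = νP + λA + μB` with `λ, μ > 0`; pairing with `U` gives `ν > 0`; pairing with `D` gives
`β(C,D) > 0`.  (Chart picture: `c` lies in the open triangle `0 a b`, so `d·c < 1`.) [folklore] -/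
theorem lambda_normalized_false (p₀ p₁ p₂ u₀ u₁ u₂ a₀ a₁ a₂ b₀ b₁ b₂ c₀ c₁ c₂ d₀ d₁ d₂ : ℝ)
    (hP : 0 < p₀ * p₂ - p₁ ^ 2) (hU : 0 < u₀ * u₂ - u₁ ^ 2) (htU : 0 < p₀ * u₂ + p₂ * u₀ - 2 * (p₁ * u₁))
    (htA : 0 < p₀ * a₂ + p₂ * a₀ - 2 * (p₁ * a₁)) (htB : 0 < p₀ * b₂ + p₂ * b₀ - 2 * (p₁ * b₁))
    (htC : 0 < p₀ * c₂ + p₂ * c₀ - 2 * (p₁ * c₁)) (htD : 0 < p₀ * d₂ + p₂ * d₀ - 2 * (p₁ * d₁))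
    (hUA : u₀ * a₂ + u₂ * a₀ - 2 * (u₁ * a₁) < 0) (hUB : u₀ * b₂ + u₂ * b₀ - 2 * (u₁ * b₁) < 0)
    (hUC : 0 < u₀ * c₂ + u₂ * c₀ - 2 * (u₁ * c₁)) (hAB : 0 < a₀ * b₂ + a₂ * b₀ - 2 * (a₁ * b₁))
    (hAC : a₀ * c₂ + a₂ * c₀ - 2 * (a₁ * c₁) < 0) (hBC : b₀ * c₂ + b₂ * c₀ - 2 * (b₁ * c₁) < 0)
    (hAD : 0 < a₀ * d₂ + a₂ * d₀ - 2 * (a₁ * d₁)) (hBD : 0 < b₀ * d₂ + b₂ * d₀ - 2 * (b₁ * d₁))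
    (hCD : c₀ * d₂ + c₂ * d₀ - 2 * (c₁ * d₁) < 0) : False := by
  have hBA : 0 < b₀ * a₂ + b₂ * a₀ - 2 * (b₁ * a₁) := by linarith [hAB]
  have s2 := lambda_side_pos p₀ p₁ p₂ u₀ u₁ u₂ a₀ a₁ a₂ b₀ b₁ b₂ c₀ c₁ c₂ hP hU htU htA htB htC hUA hUB hUC hAB
    hAC hBC
  have s3 := lambda_side_pos p₀ p₁ p₂ u₀ u₁ u₂ b₀ b₁ b₂ a₀ a₁ a₂ c₀ c₁ c₂ hP hU htU htB htA htC hUB hUA hUC hBA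
    hBC hAC
  set S0 := p₀ * (a₁ * b₂ - a₂ * b₁) - p₁ * (a₀ * b₂ - a₂ * b₀) + p₂ * (a₀ * b₁ - a₁ * b₀) with hS0
  set S1 := c₀ * (a₁ * b₂ - a₂ * b₁) - c₁ * (a₀ * b₂ - a₂ * b₀) + c₂ * (a₀ * b₁ - a₁ * b₀) with hS1
  set S2 := p₀ * (c₁ * b₂ - c₂ * b₁) - p₁ * (c₀ * b₂ - c₂ * b₀) + p₂ * (c₀ * b₁ - c₁ * b₀) with hS2
  set S3 := p₀ * (a₁ * c₂ - a₂ * c₁) - p₁ * (a₀ * c₂ - a₂ * c₀) + p₂ * (a₀ * c₁ - a₁ * c₀) with hS3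
  have e2 : (p₀ * (b₁ * a₂ - b₂ * a₁) - p₁ * (b₀ * a₂ - b₂ * a₀) + p₂ * (b₀ * a₁ - b₁ * a₀))
      * (p₀ * (b₁ * c₂ - b₂ * c₁) - p₁ * (b₀ * c₂ - b₂ * c₀) + p₂ * (b₀ * c₁ - b₁ * c₀)) = S0 * S2 := by
    rw [hS0, hS2]; ring
  have e3 : (p₀ * (a₁ * b₂ - a₂ * b₁) - p₁ * (a₀ * b₂ - a₂ * b₀) + p₂ * (a₀ * b₁ - a₁ * b₀))
      * (p₀ * (a₁ * c₂ - a₂ * c₁) - p₁ * (a₀ * c₂ - a₂ * c₀) + p₂ * (a₀ * c₁ - a₁ * c₀)) = S0 * S3 := by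
    rw [hS0, hS3]
  rw [e2] at s2
  rw [e3] at s3
  have cU := cramer_polar_identity p₀ p₁ p₂ a₀ a₁ a₂ b₀ b₁ b₂ c₀ c₁ c₂ u₀ u₁ u₂
  have cD := cramer_polar_identity p₀ p₁ p₂ a₀ a₁ a₂ b₀ b₁ b₂ c₀ c₁ c₂ d₀ d₁ d₂
  simp only [← hS0, ← hS1, ← hS2, ← hS3] at cU cD
  -- symmetric pairings
  have yCU : c₀ * u₂ + c₂ * u₀ - 2 * (c₁ * u₁) = u₀ * c₂ + u₂ * c₀ - 2 * (u₁ * c₁) := by ring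
  have yAU : a₀ * u₂ + a₂ * u₀ - 2 * (a₁ * u₁) = u₀ * a₂ + u₂ * a₀ - 2 * (u₁ * a₁) := by ring
  have yBU : b₀ * u₂ + b₂ * u₀ - 2 * (b₁ * u₁) = u₀ * b₂ + u₂ * b₀ - 2 * (u₁ * b₁) := by ring
  rw [yCU, yAU, yBU] at cU
  -- pairing with U: S0·S1 > 0
  have k1 : 0 < S0 * S1 := by
    have h0 : 0 ≤ S0 * S0 * (u₀ * c₂ + u₂ * c₀ - 2 * (u₁ * c₁)) := mul_nonneg (mul_self_nonneg S0) hUC.le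
    have h2 : S0 * S2 * (u₀ * a₂ + u₂ * a₀ - 2 * (u₁ * a₁)) < 0 := mul_neg_of_pos_of_neg s2 hUA
    have h3 : S0 * S3 * (u₀ * b₂ + u₂ * b₀ - 2 * (u₁ * b₁)) < 0 := mul_neg_of_pos_of_neg s3 hUB
    have eq : S0 * S0 * (u₀ * c₂ + u₂ * c₀ - 2 * (u₁ * c₁)) = S0 * S1 * (p₀ * u₂ + p₂ * u₀ - 2 * (p₁ * u₁))
        + S0 * S2 * (u₀ * a₂ + u₂ * a₀ - 2 * (u₁ * a₁)) + S0 * S3 * (u₀ * b₂ + u₂ * b₀ - 2 * (u₁ * b₁)) := by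
      rw [mul_assoc, cU]; ring
    have h4 : 0 < S0 * S1 * (p₀ * u₂ + p₂ * u₀ - 2 * (p₁ * u₁)) := by linarith
    exact pos_of_mul_pos_left h4 htU.le
  -- pairing with D: β(C,D) > 0, contradiction
  have h1 : 0 < S0 * S1 * (p₀ * d₂ + p₂ * d₀ - 2 * (p₁ * d₁)) := mul_pos k1 htD
  have h2 : 0 < S0 * S2 * (a₀ * d₂ + a₂ * d₀ - 2 * (a₁ * d₁)) := mul_pos s2 hAD
  have h3 : 0 < S0 * S3 * (b₀ * d₂ + b₂ * d₀ - 2 * (b₁ * d₁)) := mul_pos s3 hBD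
  have h0 : S0 * S0 * (c₀ * d₂ + c₂ * d₀ - 2 * (c₁ * d₁)) ≤ 0 :=
    mul_nonpos_of_nonneg_of_nonpos (mul_self_nonneg S0) hCD.le
  have eq : S0 * S0 * (c₀ * d₂ + c₂ * d₀ - 2 * (c₁ * d₁)) = S0 * S1 * (p₀ * d₂ + p₂ * d₀ - 2 * (p₁ * d₁))
      + S0 * S2 * (a₀ * d₂ + a₂ * d₀ - 2 * (a₁ * d₁)) + S0 * S3 * (b₀ * d₂ + b₂ * d₀ - 2 * (b₁ * d₁)) := by
    rw [mul_assoc, cD]; ring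
  linarith

/-- **Λ-RULE** (sign-pattern form; flip-invariant «twist» products).  Two DEFINITE letters `P, U` and four letters
`A B C D` cannot have polarised determinants with: triangles `(P,U,A)`, `(P,U,B)` odd and `(P,U,C)` even (`U` opposite
to `P` across `A` and `B`, with `P` across `C`), `(P,A,B)` even, `(P,A,C)`, `(P,B,C)` odd, `(P,A,D)`, `(P,B,D)` even,
`(P,C,D)` odd.  Reduction to `lambda_normalized_false` by the rescaling `X̃ := β(P,X)·X`. [folklore] -/
theorem lambda_rule_false (p₀ p₁ p₂ u₀ u₁ u₂ a₀ a₁ a₂ b₀ b₁ b₂ c₀ c₁ c₂ d₀ d₁ d₂ : ℝ)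
    (hP : 0 < p₀ * p₂ - p₁ ^ 2) (hU : 0 < u₀ * u₂ - u₁ ^ 2)
    (hA : (p₀ * u₂ + p₂ * u₀ - 2 * (p₁ * u₁)) * (p₀ * a₂ + p₂ * a₀ - 2 * (p₁ * a₁))
      * (u₀ * a₂ + u₂ * a₀ - 2 * (u₁ * a₁)) < 0)
    (hB : (p₀ * u₂ + p₂ * u₀ - 2 * (p₁ * u₁)) * (p₀ * b₂ + p₂ * b₀ - 2 * (p₁ * b₁))
      * (u₀ * b₂ + u₂ * b₀ - 2 * (u₁ * b₁)) < 0)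
    (hC : 0 < (p₀ * u₂ + p₂ * u₀ - 2 * (p₁ * u₁)) * (p₀ * c₂ + p₂ * c₀ - 2 * (p₁ * c₁))
      * (u₀ * c₂ + u₂ * c₀ - 2 * (u₁ * c₁)))
    (hAB : 0 < (p₀ * a₂ + p₂ * a₀ - 2 * (p₁ * a₁)) * (p₀ * b₂ + p₂ * b₀ - 2 * (p₁ * b₁))
      * (a₀ * b₂ + a₂ * b₀ - 2 * (a₁ * b₁)))
    (hAC : (p₀ * a₂ + p₂ * a₀ - 2 * (p₁ * a₁)) * (p₀ * c₂ + p₂ * c₀ - 2 * (p₁ * c₁))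
      * (a₀ * c₂ + a₂ * c₀ - 2 * (a₁ * c₁)) < 0)
    (hBC : (p₀ * b₂ + p₂ * b₀ - 2 * (p₁ * b₁)) * (p₀ * c₂ + p₂ * c₀ - 2 * (p₁ * c₁))
      * (b₀ * c₂ + b₂ * c₀ - 2 * (b₁ * c₁)) < 0)
    (hAD : 0 < (p₀ * a₂ + p₂ * a₀ - 2 * (p₁ * a₁)) * (p₀ * d₂ + p₂ * d₀ - 2 * (p₁ * d₁))
      * (a₀ * d₂ + a₂ * d₀ - 2 * (a₁ * d₁)))
    (hBD : 0 < (p₀ * b₂ + p₂ * b₀ - 2 * (p₁ * b₁)) * (p₀ * d₂ + p₂ * d₀ - 2 * (p₁ * d₁))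
      * (b₀ * d₂ + b₂ * d₀ - 2 * (b₁ * d₁)))
    (hCD : (p₀ * c₂ + p₂ * c₀ - 2 * (p₁ * c₁)) * (p₀ * d₂ + p₂ * d₀ - 2 * (p₁ * d₁))
      * (c₀ * d₂ + c₂ * d₀ - 2 * (c₁ * d₁)) < 0) : False := by
  set tU := p₀ * u₂ + p₂ * u₀ - 2 * (p₁ * u₁) with htU
  set tA := p₀ * a₂ + p₂ * a₀ - 2 * (p₁ * a₁) with htA
  set tB := p₀ * b₂ + p₂ * b₀ - 2 * (p₁ * b₁) with htB
  set tC := p₀ * c₂ + p₂ * c₀ - 2 * (p₁ * c₁) with htC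
  set tD := p₀ * d₂ + p₂ * d₀ - 2 * (p₁ * d₁) with htD
  have hU0 : tU ≠ 0 := by intro h0; rw [h0] at hA; simp at hA
  have hA0 : tA ≠ 0 := by intro h0; rw [h0] at hA; simp at hA
  have hB0 : tB ≠ 0 := by intro h0; rw [h0] at hB; simp at hB
  have hC0 : tC ≠ 0 := by intro h0; rw [h0] at hC; simp at hC
  have hD0 : tD ≠ 0 := by intro h0; rw [h0] at hCD; simp at hCD
  refine lambda_normalized_false p₀ p₁ p₂ (tU * u₀) (tU * u₁) (tU * u₂) (tA * a₀) (tA * a₁) (tA * a₂)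
    (tB * b₀) (tB * b₁) (tB * b₂) (tC * c₀) (tC * c₁) (tC * c₂) (tD * d₀) (tD * d₁) (tD * d₂) hP
    ?_ ?_ ?_ ?_ ?_ ?_ ?_ ?_ ?_ ?_ ?_ ?_ ?_ ?_ ?_
  · have e : tU * u₀ * (tU * u₂) - (tU * u₁) ^ 2 = tU ^ 2 * (u₀ * u₂ - u₁ ^ 2) := by ring
    rw [e]; positivity
  · have e : p₀ * (tU * u₂) + p₂ * (tU * u₀) - 2 * (p₁ * (tU * u₁)) = tU ^ 2 := by rw [htU]; ring
    rw [e]; positivity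
  · have e : p₀ * (tA * a₂) + p₂ * (tA * a₀) - 2 * (p₁ * (tA * a₁)) = tA ^ 2 := by rw [htA]; ring
    rw [e]; positivity
  · have e : p₀ * (tB * b₂) + p₂ * (tB * b₀) - 2 * (p₁ * (tB * b₁)) = tB ^ 2 := by rw [htB]; ring
    rw [e]; positivity
  · have e : p₀ * (tC * c₂) + p₂ * (tC * c₀) - 2 * (p₁ * (tC * c₁)) = tC ^ 2 := by rw [htC]; ring
    rw [e]; positivity
  · have e : p₀ * (tD * d₂) + p₂ * (tD * d₀) - 2 * (p₁ * (tD * d₁)) = tD ^ 2 := by rw [htD]; ring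
    rw [e]; positivity
  · have e : tU * u₀ * (tA * a₂) + tU * u₂ * (tA * a₀) - 2 * (tU * u₁ * (tA * a₁))
        = tU * tA * (u₀ * a₂ + u₂ * a₀ - 2 * (u₁ * a₁)) := by ring
    rw [e]; linarith [hA]
  · have e : tU * u₀ * (tB * b₂) + tU * u₂ * (tB * b₀) - 2 * (tU * u₁ * (tB * b₁))
        = tU * tB * (u₀ * b₂ + u₂ * b₀ - 2 * (u₁ * b₁)) := by ring
    rw [e]; linarith [hB]
  · have e : tU * u₀ * (tC * c₂) + tU * u₂ * (tC * c₀) - 2 * (tU * u₁ * (tC * c₁))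
        = tU * tC * (u₀ * c₂ + u₂ * c₀ - 2 * (u₁ * c₁)) := by ring
    rw [e]; linarith [hC]
  · have e : tA * a₀ * (tB * b₂) + tA * a₂ * (tB * b₀) - 2 * (tA * a₁ * (tB * b₁))
        = tA * tB * (a₀ * b₂ + a₂ * b₀ - 2 * (a₁ * b₁)) := by ring
    rw [e]; linarith [hAB]
  · have e : tA * a₀ * (tC * c₂) + tA * a₂ * (tC * c₀) - 2 * (tA * a₁ * (tC * c₁))
        = tA * tC * (a₀ * c₂ + a₂ * c₀ - 2 * (a₁ * c₁)) := by ring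
    rw [e]; linarith [hAC]
  · have e : tB * b₀ * (tC * c₂) + tB * b₂ * (tC * c₀) - 2 * (tB * b₁ * (tC * c₁))
        = tB * tC * (b₀ * c₂ + b₂ * c₀ - 2 * (b₁ * c₁)) := by ring
    rw [e]; linarith [hBC]
  · have e : tA * a₀ * (tD * d₂) + tA * a₂ * (tD * d₀) - 2 * (tA * a₁ * (tD * d₁))
        = tA * tD * (a₀ * d₂ + a₂ * d₀ - 2 * (a₁ * d₁)) := by ring
    rw [e]; linarith [hAD]
  · have e : tB * b₀ * (tD * d₂) + tB * b₂ * (tD * d₀) - 2 * (tB * b₁ * (tD * d₁))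
        = tB * tD * (b₀ * d₂ + b₂ * d₀ - 2 * (b₁ * d₁)) := by ring
    rw [e]; linarith [hBD]
  · have e : tC * c₀ * (tD * d₂) + tC * c₂ * (tD * d₀) - 2 * (tC * c₁ * (tD * d₁))
        = tC * tD * (c₀ * d₂ + c₂ * d₀ - 2 * (c₁ * d₁)) := by ring
    rw [e]; linarith [hCD]

end Summit.ValiantsHypothesis.ValiantsHypothesis.Theorems.LacunarySymmetroidMatrixDescartes.Census
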